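import Literature.AlgebraicGeometry.Frobenioids.EquivalenceIstrSquare
import Literature.AlgebraicGeometry.Frobenioids.DivisorMonoidCategoryTheoreticityCorProofsV
import HarnessLib

/-!
# Frobenioids I, Corollary 4.12 — the reduction "without loss of generality `C₁`, `C₂` are of isotropic
# type": the square over `F_{0_D} = D × N_{≥1}` descends along the isotropification functors

Mochizuki, *The geometry of Frobenioids I: the general theory*, Kyushu J. Math. **62** (2008)
293–400, kurims text, proof of Cor. 4.12 p. 95 ll. 18–19 [cite: MochizukiFrdI2008, Cor. 4.12 p.95]:
"First, we observe [cf. Theorem 3.4, (i)] that we may assume without loss of generality that `C₁`, `C₂`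
are of isotropic type [cf. Remark 4.5.1]."

PROOF-ONLY (cell sub-DAG W9 = `plan/L1/SUBDAG-FrdI-Cor412.md`, row C412-L00; seat abc-iut-w5-d222).
The mechanism behind "[cf. Theorem 3.4, (i)]": the projection `C → F_{0_D} = D × N_{≥1}`
(`PreFrobenioidData.toBaseDeg`, "determined by the Frobenius degree and the projection to `D`") factors —
up to a canonical isomorphism — through the isotropification functor `C → C^istr` of Prop. 1.9 (v)
(abc-iut-L1-t1's `PreFrobenioid.isotropification`, "through which the functor `C → F_Φ` factors",
`isotropificationFactorsIso`): an isotropic hull `A → A^istr` is an isometric pre-step, so its image in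
`F_{0_D}` is an isomorphism. Hence a square for `Ψ^istr : C₁^istr ⥲ C₂^istr` (Thm. 3.4 (i):
`isotropification₁ ⋙ Ψ^istr ≅ Ψ ⋙ isotropification₂`, abc-iut-w4-d088's `nonempty_isotropification_comp_iso`)
over the projections `C_i^istr → F_{0_{D_i}}` yields the square for `Ψ` over `C_i → F_{0_{D_i}}`:

* `PreFrobenioid.toBaseDeg_eq_comp_elem`: `(C → F_{0_D}) = F ⋙ (F_Φ → F_{0_D})` on the nose;
* `PreFrobenioid.exists_toBaseDeg_equivalence_of_istr`: the descent of the square along the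
  isotropifications;
* `PreFrobenioid.cor412_of_istr`: hence the typed Cor. 4.12 (`PreFrobenioidData.Cor412`) for `Ψ` from a
  square for `Ψ^istr` (`1`-uniqueness `BaseDegSquare`, rigidity Prop. 1.13 (i) — abc-iut-L1-d6's
  `cor412_of_exists_toBaseDeg_equivalence`, kernel-checked for Frobenioids).

No statement of the paper is restated as a `Prop` or strengthened; nothing here is specific to the abc
programme or bears on [IUTchIII] Cor. 3.12.
-/

namespace Literature.AlgebraicGeometry.Frobenioids

open CategoryTheory Opposite

universe w v v' u u'

namespace PreFrobenioid

section OneFrobenioid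

variable {D : Type u} [Category.{v} D] {Φ : Dᵒᵖ ⥤ CommMonCat.{w}}
  {C : Type u'} [Category.{v'} C]

/-- The projection `C → F_{0_D} = D × N_{≥1}` of `C → F_Φ` is, ON THE NOSE, `C → F_Φ` followed by the
projection `F_Φ → F_{0_D}` of the elementary Frobenioid itself ([FrdI] Prop. 4.4 (i) p. 83: "determined by
the Frobenius degree and the projection to `D`"). [cite: MochizukiFrdI2008, Cor. 4.12 p.95] -/
theorem toBaseDeg_eq_comp_elem (F : C ⥤ ElemFrobenioid Φ) :
    (PreFrobenioidData.ofFunctor Φ F).toBaseDeg =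
      F ⋙ (PreFrobenioidData.ofFunctor Φ (𝟭 (ElemFrobenioid Φ))).toBaseDeg :=
  Functor.hext (fun _ => rfl) fun _ _ _ => HEq.rfl

variable {F : C ⥤ ElemFrobenioid Φ}

/-- **"We may assume without loss of generality that `C` is of isotropic type [cf. Theorem 3.4, (i)]"**
([FrdI] p. 95 ll. 18–19), the mechanism: the projection `C → F_{0_D}` is canonically isomorphic to the
isotropification functor `C → C^istr` (Prop. 1.9 (v)) followed by the projection `C^istr → F_{0_D}` — the
image in `F_{0_D}` of an isotropic hull (an isometric pre-step) being an isomorphism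
(`isotropificationFactorsIso`, abc-iut-L1-t1). [cite: MochizukiFrdI2008, Cor. 4.12 p.95] -/
theorem nonempty_toBaseDeg_iso_isotropification_comp (hF : IsFrobenioid F) :
    Nonempty ((PreFrobenioidData.ofFunctor Φ F).toBaseDeg ≅
      isotropification hF ⋙ (PreFrobenioidData.ofFunctor Φ (istrFunctor F)).toBaseDeg) :=
  ⟨eqToIso (toBaseDeg_eq_comp_elem F) ≪≫
    Functor.isoWhiskerRight (isotropificationFactorsIso hF) _ ≪≫ Functor.associator _ _ _ ≪≫
      Functor.isoWhiskerLeft (isotropification hF) (eqToIso (toBaseDeg_eq_comp_elem (istrFunctor F)).symm)⟩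

end OneFrobenioid

section TwoFrobenioids

variable {D₁ : Type u} [Category.{v} D₁] {Φ₁ : D₁ᵒᵖ ⥤ CommMonCat.{w}}
  {C₁ : Type u'} [Category.{v'} C₁] {F₁ : C₁ ⥤ ElemFrobenioid Φ₁}
  {D₂ : Type u} [Category.{v} D₂] {Φ₂ : D₂ᵒᵖ ⥤ CommMonCat.{w}}
  {C₂ : Type u'} [Category.{v'} C₂] {F₂ : C₂ ⥤ ElemFrobenioid Φ₂}

/-- **C412-L00, the descent** ([FrdI] proof of Cor. 4.12, p. 95 ll. 18–19 "we may assume without loss of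
generality that `C₁`, `C₂` are of isotropic type [cf. Theorem 3.4, (i)]"): let `Ψ^istr : C₁^istr ⥲ C₂^istr`
be an equivalence with `isotropification₁ ⋙ Ψ^istr ≅ Ψ ⋙ isotropification₂` (Thm. 3.4 (i); in the tree
`Ψ.congrFullSubcategory …` with `nonempty_isotropification_comp_iso`). If there is an equivalence
`Ψ⁰ : F_{0_{D₁}} ⥲ F_{0_{D₂}}` `1`-commuting with `Ψ^istr` over the projections `C_i^istr → F_{0_{D_i}}`, then
`Ψ⁰` `1`-commutes with `Ψ` over the projections `C_i → F_{0_{D_i}}`. [cite: MochizukiFrdI2008, Cor. 4.12 p.95] -/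
theorem exists_toBaseDeg_equivalence_of_istr (hF₁ : IsFrobenioid F₁) (hF₂ : IsFrobenioid F₂) (Ψ : C₁ ≌ C₂)
    (Ψi : Istr F₁ ≌ Istr F₂) (core : isotropification hF₁ ⋙ Ψi.functor ≅ Ψ.functor ⋙ isotropification hF₂)
    (hex : ∃ Ψ0 : D₁ × SingleObj ℕ+ ⥤ D₂ × SingleObj ℕ+, Ψ0.IsEquivalence ∧
      OneCommutes Ψi.functor (PreFrobenioidData.ofFunctor Φ₂ (istrFunctor F₂)).toBaseDeg
        (PreFrobenioidData.ofFunctor Φ₁ (istrFunctor F₁)).toBaseDeg Ψ0) :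
    ∃ Ψ0 : D₁ × SingleObj ℕ+ ⥤ D₂ × SingleObj ℕ+, Ψ0.IsEquivalence ∧
      OneCommutes Ψ.functor (PreFrobenioidData.ofFunctor Φ₂ F₂).toBaseDeg
        (PreFrobenioidData.ofFunctor Φ₁ F₁).toBaseDeg Ψ0 := by
  obtain ⟨Ψ0, hEq, ⟨τ⟩⟩ := hex
  obtain ⟨θ₁⟩ := nonempty_toBaseDeg_iso_isotropification_comp hF₁
  obtain ⟨θ₂⟩ := nonempty_toBaseDeg_iso_isotropification_comp hF₂
  refine ⟨Ψ0, hEq, ⟨?_⟩⟩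
  exact Functor.isoWhiskerLeft Ψ.functor θ₂ ≪≫ (Functor.associator _ _ _).symm ≪≫
    Functor.isoWhiskerRight core.symm _ ≪≫ Functor.associator _ _ _ ≪≫
      Functor.isoWhiskerLeft (isotropification hF₁) τ ≪≫ (Functor.associator _ _ _).symm ≪≫
        Functor.isoWhiskerRight θ₁.symm Ψ0

/-- **C412-L00: Corollary 4.12 for `Ψ` from the square for `Ψ^istr`** ([FrdI] p. 95 ll. 18–19 with the
rest of the statement of Cor. 4.12): under the hypotheses of `exists_toBaseDeg_equivalence_of_istr`, the
typed Cor. 4.12 (`PreFrobenioidData.Cor412`) holds for `Ψ`, for all parameters `R_i` — "there exists a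
1-unique functor `Ψ⁰`" (`BaseDegSquare`) and "if `D₁`, `D₂` are slim, then each of the composite functors
… is rigid … Proposition 1.13, (i)" being theorems for Frobenioids (`cor412_of_exists_toBaseDeg_equivalence`,
abc-iut-L1-d6). [cite: MochizukiFrdI2008, Cor. 4.12 p.95] -/
theorem cor412_of_istr (hF₁ : IsFrobenioid F₁) (hF₂ : IsFrobenioid F₂) (Ψ : C₁ ≌ C₂)
    (Ψi : Istr F₁ ≌ Istr F₂) (core : isotropification hF₁ ⋙ Ψi.functor ≅ Ψ.functor ⋙ isotropification hF₂)
    (hex : ∃ Ψ0 : D₁ × SingleObj ℕ+ ⥤ D₂ × SingleObj ℕ+, Ψ0.IsEquivalence ∧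
      OneCommutes Ψi.functor (PreFrobenioidData.ofFunctor Φ₂ (istrFunctor F₂)).toBaseDeg
        (PreFrobenioidData.ofFunctor Φ₁ (istrFunctor F₁)).toBaseDeg Ψ0)
    (R₁ : (PreFrobenioidData.ofFunctor Φ₁ F₁).RSParams) (R₂ : (PreFrobenioidData.ofFunctor Φ₂ F₂).RSParams) :
    (PreFrobenioidData.ofFunctor Φ₁ F₁).Cor412 (PreFrobenioidData.ofFunctor Φ₂ F₂) Ψ R₁ R₂ :=
  PreFrobenioidData.cor412_of_exists_toBaseDeg_equivalence _ _ Ψ R₁ R₂ (exists_base_iso_of_isFrobenioid F₁ hF₁)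
    (exists_linear_preSteps_of_base_iso F₁ hF₁) (fun A _ f => exists_linear_arrow_over_base F₁ hF₁ A f)
    (exists_baseIso_of_degFr F₁ hF₁) (exists_toBaseDeg_equivalence_of_istr hF₁ hF₂ Ψ Ψi core hex)
    (fun _ h₂ => IsRigidFunctor.comp_of_isEquivalence Ψ.functor (isRigidFunctor_baseFunctor hF₂ h₂))

end TwoFrobenioids

end PreFrobenioid

end Literature.AlgebraicGeometry.Frobenioids
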